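import Literature.MathematicalPhysics.QuantumManyBody.BoseEinsteinCondensation
import Mathlib.MeasureTheory.Integral.Lebesgue.Add
import Mathlib.Analysis.SpecialFunctions.Exp

/-!
# Crux `BoundaryTransferWeak` (stmt-AtomisticToContinuum-0827, routes `BECInsertionCorrector` /
# `BECPeriodicReduction`), line `Sketch` (coupled-bath-relocation): stub `stub_multiplicativeTransfer`

**Multiplicative Bhattacharyya flatness transfer.**  If two nonnegative functions `f, g` on a
measurable set `C ⊆ ℝ³` satisfy the pairwise relocation bound `f x · g y ≤ e^M · f y · g x`
(`x, y ∈ C`), then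
`(∫_C g)² · ∫_C f² ≤ e^{2M} · (∫_C f)² · ∫_C g²`,
i.e. the Bhattacharyya flatness `(∫ φ)² / (|C| ∫ φ²)` of `f` is at least `e^{-2M}` times that of
`g`.  The statement is division-free, hence true in all degenerate cases (zero or infinite
integrals).  Proof (three-line Tonelli, done as two iterated two-variable steps): for
`x, z ∈ C` the bound at `(z, x)` reads `f z · g x ≤ e^M · f x · g z`; multiplying by a third
nonnegative factor `h z` and integrating over `(x, z) ∈ C²` gives
`(∫_C g) · ∫_C f h ≤ e^M · (∫_C f) · ∫_C h g`; apply this with `h = f` and then with `h = g`.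
[folklore]
-/

noncomputable section

namespace Summit.AtomisticToContinuum.BoseEinsteinCondensation.CoupledBaths

open Literature.MathematicalPhysics.QuantumManyBody.BoseGas MeasureTheory
open scoped ENNReal NNReal

section Helpers

/-- One Tonelli step of the transfer: from the pointwise bound `F z · G x ≤ E · F x · G z` on
`s × s`, for every measurable weight `H`, `(∫_s G) · ∫_s F H ≤ E · (∫_s F) · ∫_s H G`
(all in `ℝ≥0∞`, iterated integrals only). [folklore] -/
private theorem setLIntegral_mul_transfer {α : Type*} [MeasurableSpace α] {μ : Measure α}
    {s : Set α} (hs : MeasurableSet s) {F G H : α → ℝ≥0∞} {E : ℝ≥0∞}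
    (hF : Measurable F) (hG : Measurable G) (hH : Measurable H)
    (h : ∀ x ∈ s, ∀ z ∈ s, F z * G x ≤ E * (F x * G z)) :
    (∫⁻ x in s, G x ∂μ) * ∫⁻ z in s, F z * H z ∂μ ≤
      E * ((∫⁻ x in s, F x ∂μ) * ∫⁻ z in s, H z * G z ∂μ) := by
  calc (∫⁻ x in s, G x ∂μ) * ∫⁻ z in s, F z * H z ∂μ
      = ∫⁻ z in s, (∫⁻ x in s, G x ∂μ) * (F z * H z) ∂μ :=
        (lintegral_const_mul _ (hF.mul hH)).symm
    _ = ∫⁻ z in s, ∫⁻ x in s, G x * (F z * H z) ∂μ ∂μ := by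
        refine lintegral_congr fun z => ?_
        exact (lintegral_mul_const _ hG).symm
    _ ≤ ∫⁻ z in s, ∫⁻ x in s, E * F x * (G z * H z) ∂μ ∂μ := by
        refine setLIntegral_mono' hs fun z hz => setLIntegral_mono' hs fun x hx => ?_
        calc G x * (F z * H z) = F z * G x * H z := by ring
          _ ≤ E * (F x * G z) * H z := mul_le_mul_left (h x hx z hz) _
          _ = E * F x * (G z * H z) := by ring
    _ = ∫⁻ z in s, E * (∫⁻ x in s, F x ∂μ) * (G z * H z) ∂μ := by
        refine lintegral_congr fun z => ?_
        rw [lintegral_mul_const _ (hF.const_mul E), lintegral_const_mul _ hF]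
    _ = E * (∫⁻ x in s, F x ∂μ) * ∫⁻ z in s, G z * H z ∂μ :=
        lintegral_const_mul _ (hG.mul hH)
    _ = E * ((∫⁻ x in s, F x ∂μ) * ∫⁻ z in s, H z * G z ∂μ) := by
        simp_rw [mul_comm (G _) (H _), mul_assoc]

/-- The transfer in `ℝ≥0∞` generality: from `F z · G x ≤ E · F x · G z` on `s × s`,
`(∫_s G)² · ∫_s F² ≤ E² · (∫_s F)² · ∫_s G²`. [folklore] -/
private theorem sq_setLIntegral_mul_transfer {α : Type*} [MeasurableSpace α] {μ : Measure α}
    {s : Set α} (hs : MeasurableSet s) {F G : α → ℝ≥0∞} {E : ℝ≥0∞}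
    (hF : Measurable F) (hG : Measurable G)
    (h : ∀ x ∈ s, ∀ z ∈ s, F z * G x ≤ E * (F x * G z)) :
    (∫⁻ x in s, G x ∂μ) ^ 2 * ∫⁻ x in s, F x ^ 2 ∂μ ≤
      E ^ 2 * ((∫⁻ x in s, F x ∂μ) ^ 2 * ∫⁻ x in s, G x ^ 2 ∂μ) := by
  have hA := setLIntegral_mul_transfer (μ := μ) hs hF hG hF h
  have hB := setLIntegral_mul_transfer (μ := μ) hs hF hG hG h
  simp only [sq]
  calc (∫⁻ x in s, G x ∂μ) * (∫⁻ x in s, G x ∂μ) * ∫⁻ x in s, F x * F x ∂μ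
      = (∫⁻ x in s, G x ∂μ) * ((∫⁻ x in s, G x ∂μ) * ∫⁻ x in s, F x * F x ∂μ) := mul_assoc _ _ _
    _ ≤ (∫⁻ x in s, G x ∂μ) * (E * ((∫⁻ x in s, F x ∂μ) * ∫⁻ x in s, F x * G x ∂μ)) :=
        mul_le_mul_right hA _
    _ = E * (∫⁻ x in s, F x ∂μ) * ((∫⁻ x in s, G x ∂μ) * ∫⁻ x in s, F x * G x ∂μ) := by ring
    _ ≤ E * (∫⁻ x in s, F x ∂μ) * (E * ((∫⁻ x in s, F x ∂μ) * ∫⁻ x in s, G x * G x ∂μ)) :=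
        mul_le_mul_right hB _
    _ = E * E * ((∫⁻ x in s, F x ∂μ) * (∫⁻ x in s, F x ∂μ) * ∫⁻ x in s, G x * G x ∂μ) := by
        ring

end Helpers

/-- **Multiplicative Bhattacharyya flatness transfer** (card `MultiplicativeFlatnessTransfer` of
the idea `coupled-bath-relocation`): if `f, g ≥ 0` on a measurable `C ⊆ ℝ³` satisfy
`f x · g y ≤ e^M · f y · g x` for `x, y ∈ C`, then
`(∫_C g)² · ∫_C f² ≤ e^{2M} · (∫_C f)² · ∫_C g²` (lower Lebesgue integrals, division-free).
[folklore] -/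
theorem stub_multiplicativeTransfer :
    ∀ (C : Set Space) (f g : Space → ℝ) (M : ℝ), MeasurableSet C → Measurable f → Measurable g →
    (∀ x ∈ C, 0 ≤ f x) → (∀ x ∈ C, 0 ≤ g x) →
    (∀ x ∈ C, ∀ y ∈ C, f x * g y ≤ Real.exp M * (f y * g x)) →
      (∫⁻ x in C, ENNReal.ofReal (g x)) ^ 2 * ∫⁻ x in C, ENNReal.ofReal (f x) ^ 2 ≤
        ENNReal.ofReal (Real.exp (2 * M)) *
          ((∫⁻ x in C, ENNReal.ofReal (f x)) ^ 2 * ∫⁻ x in C, ENNReal.ofReal (g x) ^ 2) := by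
  intro C f g M hC hf hg hf0 _hg0 hfg
  have hFm : Measurable fun x => ENNReal.ofReal (f x) := ENNReal.measurable_ofReal.comp hf
  have hGm : Measurable fun x => ENNReal.ofReal (g x) := ENNReal.measurable_ofReal.comp hg
  have key : ∀ x ∈ C, ∀ z ∈ C, ENNReal.ofReal (f z) * ENNReal.ofReal (g x) ≤
      ENNReal.ofReal (Real.exp M) * (ENNReal.ofReal (f x) * ENNReal.ofReal (g z)) := by
    intro x hx z hz
    rw [← ENNReal.ofReal_mul (hf0 z hz), ← ENNReal.ofReal_mul (hf0 x hx),
      ← ENNReal.ofReal_mul (Real.exp_pos M).le]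
    exact ENNReal.ofReal_le_ofReal (hfg z hz x hx)
  have hE : Real.exp (2 * M) = Real.exp M ^ 2 := by rw [two_mul, Real.exp_add, sq]
  rw [hE, ENNReal.ofReal_pow (Real.exp_pos M).le]
  exact sq_setLIntegral_mul_transfer hC hFm hGm key

end Summit.AtomisticToContinuum.BoseEinsteinCondensation.CoupledBaths

end

/-! ### Appended helpers for the bath-level box transfer (`stub_boxTransferBath`, line `Sketch` v2)

Division-free `ℝ≥0∞` lemmas used by `…BoundaryTransferWeakBoxTransferBath.lean`: Cauchy–Schwarz
against `1`, square roots of products, the one-slice bound `m (∫_C ψ)²/(|C| m) ≤ |⟨u, ψ⟩|²` for the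
flat mode `u = |C|^{-1/2} 1_C`, and the in-cube MASS-FRACTION transfer from the one-directional
outside bound `ψ(y)φ(x) ≤ e^M ψ(x)φ(y)` (`x ∈ C ∖ S`, `y ∈ (D ∖ C) ∖ T`). [folklore] -/

namespace Summit.AtomisticToContinuum.BoseEinsteinCondensation.CoupledBaths.BoxTransferBath

open Literature.MathematicalPhysics.QuantumManyBody.BoseGas MeasureTheory
open scoped ENNReal NNReal ComplexConjugate

/-- Cauchy–Schwarz against `1` on a set: `(∫_C f)² ≤ |C| ∫_C f²`. [folklore] -/
theorem sq_setLIntegral_le {f : Space → ℝ≥0∞} (hf : Measurable f) (C : Set Space) :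
    (∫⁻ y in C, f y) ^ 2 ≤ volume C * ∫⁻ y in C, f y ^ 2 := by
  -- Hölder (`p = q = 2`) against the constant `1` on `volume.restrict C`
  -- (as `lintegral_mul_sq_le` of Literature/…/SwapPurity.lean, not imported by this file)
  have h := ENNReal.lintegral_mul_le_Lp_mul_Lq (volume.restrict C) Real.HolderConjugate.two_two
    hf.aemeasurable (g := fun _ => (1 : ℝ≥0∞)) aemeasurable_const
  simp only [Pi.mul_apply, mul_one, ENNReal.one_rpow, lintegral_one, Measure.restrict_apply_univ]
    at h
  calc (∫⁻ y in C, f y) ^ 2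
      ≤ ((∫⁻ y in C, f y ^ (2 : ℝ)) ^ (1 / (2 : ℝ)) * volume C ^ (1 / (2 : ℝ))) ^ 2 := by gcongr
    _ = volume C * ∫⁻ y in C, f y ^ 2 := by
        rw [mul_pow, ← ENNReal.rpow_two, ← ENNReal.rpow_two, ← ENNReal.rpow_mul,
          ← ENNReal.rpow_mul, mul_comm]
        norm_num

/-- Square roots in `ℝ≥0∞`: `α²T ≤ a²`, `b² ≤ β²T`, `0 ≤ β ≤ α`, `T < ⊤` give `(α-β)²T ≤ (a-b)²`.
[folklore] -/
theorem sq_tsub_ge {a b T : ℝ≥0∞} {α β : ℝ} (hβ : 0 ≤ β) (hβα : β ≤ α) (hT : T ≠ ⊤)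
    (ha : ENNReal.ofReal (α ^ 2) * T ≤ a ^ 2) (hb : b ^ 2 ≤ ENNReal.ofReal (β ^ 2) * T) :
    ENNReal.ofReal ((α - β) ^ 2) * T ≤ (a - b) ^ 2 := by
  -- adapted from …Theorems/BECInsertionCorrectorBoundaryTransferWeakBoxTransfer.lean
  have hbt : b ≠ ⊤ := by
    rintro rfl
    rw [ENNReal.top_pow two_ne_zero, top_le_iff] at hb
    exact ENNReal.mul_ne_top ENNReal.ofReal_ne_top hT hb
  rcases eq_or_ne a ⊤ with rfl | hat
  · rw [ENNReal.top_sub hbt, ENNReal.top_pow two_ne_zero]; exact le_top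
  obtain ⟨a', ha0, rfl⟩ : ∃ a' : ℝ, 0 ≤ a' ∧ a = ENNReal.ofReal a' :=
    ⟨a.toReal, ENNReal.toReal_nonneg, (ENNReal.ofReal_toReal hat).symm⟩
  obtain ⟨b', hb0, rfl⟩ : ∃ b' : ℝ, 0 ≤ b' ∧ b = ENNReal.ofReal b' :=
    ⟨b.toReal, ENNReal.toReal_nonneg, (ENNReal.ofReal_toReal hbt).symm⟩
  obtain ⟨s, hs0, rfl⟩ : ∃ s : ℝ, 0 ≤ s ∧ T = ENNReal.ofReal (s ^ 2) :=
    ⟨Real.sqrt T.toReal, Real.sqrt_nonneg _,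
      by rw [Real.sq_sqrt ENNReal.toReal_nonneg, ENNReal.ofReal_toReal hT]⟩
  rw [← ENNReal.ofReal_pow ha0, ← ENNReal.ofReal_mul (sq_nonneg _), ← mul_pow,
    ENNReal.ofReal_le_ofReal_iff (by positivity),
    pow_le_pow_iff_left₀ (mul_nonneg (hβ.trans hβα) hs0) ha0 two_ne_zero] at ha
  rw [← ENNReal.ofReal_pow hb0, ← ENNReal.ofReal_mul (sq_nonneg _), ← mul_pow,
    ENNReal.ofReal_le_ofReal_iff (by positivity),
    pow_le_pow_iff_left₀ hb0 (mul_nonneg hβ hs0) two_ne_zero] at hb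
  have h3 : (α - β) * s ≤ a' - b' := by nlinarith
  have h4 : 0 ≤ (α - β) * s := mul_nonneg (by linarith) hs0
  rw [← ENNReal.ofReal_sub _ hb0, ← ENNReal.ofReal_pow (by linarith),
    ← ENNReal.ofReal_mul (sq_nonneg _), ← mul_pow, ENNReal.ofReal_le_ofReal_iff (by positivity)]
  exact pow_le_pow_left₀ h4 h3 2

/-- **One slice of the disintegration** (pointwise in the bath, degenerate slices included):
`m · (∫_C ψ)² / (|C| m) ≤ |⟨u, ψ⟩|²` for `ψ ≥ 0`, `|C| = a²`, `u = a⁻¹ 1_C` and any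
`m ≥ ∫_C ψ²` (e.g. `m = ∫ ψ²`, the bath-level normalisation). [folklore] -/
theorem slice_bound {C : Set Space} (hC : MeasurableSet C) {a : ℝ} (ha : 0 < a)
    (hV : volume C = ENNReal.ofReal (a ^ 2)) {ψ : Space → ℝ} (hψ : Measurable ψ)
    (hψ0 : ∀ x, 0 ≤ ψ x) {m : ℝ≥0∞} (hm : ∫⁻ x in C, ENNReal.ofReal (ψ x) ^ 2 ≤ m) :
    m * ((∫⁻ x in C, ENNReal.ofReal (ψ x)) ^ 2 / (volume C * m)) ≤
      (‖∫ x, conj (C.indicator (fun _ => ((a : ℂ))⁻¹) x) * (ψ x : ℂ)‖₊ : ℝ≥0∞) ^ 2 := by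
  -- adapted from …Theorems/BECInsertionCorrectorBoundaryTransferWeakBoxTransfer.lean
  set V : ℝ≥0∞ := volume C with hVdef
  set J : ℝ≥0∞ := ∫⁻ x in C, ENNReal.ofReal (ψ x) with hJ
  have hV0 : V ≠ 0 := by rw [hV]; exact (ENNReal.ofReal_pos.mpr (by positivity)).ne'
  rcases eq_or_ne m 0 with hm0 | hm0
  · rw [hm0, zero_mul]; exact zero_le
  rcases eq_or_ne m ⊤ with hmt | hmt
  · rw [hmt, ENNReal.mul_top hV0, ENNReal.div_top, mul_zero]; exact zero_le
  rw [mul_comm V m, ← mul_div_assoc, ENNReal.mul_div_mul_left _ _ hm0 hmt]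
  -- `J` is finite (Cauchy–Schwarz), so `ψ` is integrable on `C`
  have hJ2 : J ^ 2 ≤ V * m :=
    (sq_setLIntegral_le hψ.ennreal_ofReal C).trans (mul_le_mul' le_rfl hm)
  have hJt : J ≠ ⊤ := fun h => by
    rw [h, ENNReal.top_pow two_ne_zero, top_le_iff] at hJ2
    exact ENNReal.mul_ne_top (hV ▸ ENNReal.ofReal_ne_top) hmt hJ2
  have hint : Integrable ψ (volume.restrict C) := by
    refine ⟨hψ.aestronglyMeasurable, ?_⟩
    rw [HasFiniteIntegral]
    calc ∫⁻ x in C, ‖ψ x‖ₑ = J := lintegral_congr fun x => Real.enorm_eq_ofReal (hψ0 x)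
      _ < ⊤ := hJt.lt_top
  have hIeq : ENNReal.ofReal (∫ x in C, ψ x) = J :=
    ofReal_integral_eq_lintegral_ofReal hint (Filter.Eventually.of_forall fun x => hψ0 x)
  -- the pairing with the flat mode
  have hI : (∫ x, conj (C.indicator (fun _ => ((a : ℂ))⁻¹) x) * (ψ x : ℂ)) =
      ((a⁻¹ * ∫ x in C, ψ x : ℝ) : ℂ) := by
    have h : (fun x => conj (C.indicator (fun _ => ((a : ℂ))⁻¹) x) * (ψ x : ℂ)) =
        C.indicator (fun x => ((a⁻¹ * ψ x : ℝ) : ℂ)) := by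
      funext x
      by_cases hx : x ∈ C
      · simp [Set.indicator_of_mem hx]
      · simp [hx]
    rw [h, integral_indicator hC, integral_complex_ofReal, integral_const_mul]
  rw [hI, Complex.nnnorm_real, ← enorm_eq_nnnorm,
    Real.enorm_eq_ofReal (mul_nonneg (inv_nonneg.mpr ha.le) (integral_nonneg hψ0)),
    ENNReal.ofReal_mul (inv_nonneg.mpr ha.le), hIeq, ENNReal.ofReal_inv_of_pos ha, mul_pow,
    ← ENNReal.inv_pow, ← ENNReal.ofReal_pow ha.le, ← hV, div_eq_mul_inv, mul_comm]

/-- **Mass-fraction transfer** (the pointwise `q_C` core of the bath-level box transfer): if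
`ψ ≥ 0` vanishes off `D ⊇ C` and has finite mass, `φ ≥ 0` has positive `C`-mass and `D`-mass
fraction `∫_C φ² ≥ (c/16) ∫_D φ² ` (`∫_D φ² < ⊤`), the exceptional sets `S ⊆ C`, `T` carry `φ`-mass
`≤ ε ∫_C φ²` resp. `ψ`-mass `≤ ε ∫ ψ²`, and the one-directional outside bound
`ψ(y)φ(x) ≤ e^M ψ(x)φ(y)` holds for `x ∈ C ∖ S`, `y ∈ (D ∖ C) ∖ T`, then `κ₁ ∫ ψ² ≤ ∫_C ψ²`,
`κ₁ = (1-ε)/(1 + 16e^{2M}/(c(1-ε)))` (square the bound, integrate over `(C ∖ S) × ((D ∖ C) ∖ T)`,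
cancel `∫_C φ² ∈ (0, ⊤)`). [folklore] -/
theorem massFraction_core {C D S T : Set Space} {ψ φ : Space → ℝ} {c ε M : ℝ}
    (hC : MeasurableSet C) (hD : MeasurableSet D) (hCD : C ⊆ D) (hS : MeasurableSet S)
    (hSC : S ⊆ C) (hT : MeasurableSet T) (hψm : Measurable ψ) (hφm : Measurable φ)
    (hψ0 : ∀ x, 0 ≤ ψ x) (hφ0 : ∀ x, 0 ≤ φ x) (hψD : ∀ y, y ∉ D → ψ y = 0) (hc : 0 < c)
    (hε : 0 < ε) (hε1 : ε < 1) (hmAllt : ∫⁻ x, ENNReal.ofReal (ψ x) ^ 2 < ⊤)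
    (hmφ0 : 0 < ∫⁻ y in C, ENNReal.ofReal (φ y) ^ 2)
    (hmφDt : ∫⁻ y in D, ENNReal.ofReal (φ y) ^ 2 < ⊤)
    (hfrac : ENNReal.ofReal (c / 16) * ∫⁻ y in D, ENNReal.ofReal (φ y) ^ 2 ≤
      ∫⁻ y in C, ENNReal.ofReal (φ y) ^ 2)
    (hSφ : ∫⁻ y in S, ENNReal.ofReal (φ y) ^ 2 ≤
      ENNReal.ofReal ε * ∫⁻ y in C, ENNReal.ofReal (φ y) ^ 2)
    (hTψ : ∫⁻ y in T, ENNReal.ofReal (ψ y) ^ 2 ≤ ENNReal.ofReal ε * ∫⁻ x, ENNReal.ofReal (ψ x) ^ 2)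
    (hout : ∀ x ∈ C \ S, ∀ y ∈ (D \ C) \ T, ψ y * φ x ≤ Real.exp M * (ψ x * φ y)) :
    ENNReal.ofReal ((1 - ε) / (1 + 16 * Real.exp (2 * M) / (c * (1 - ε)))) *
        ∫⁻ x, ENNReal.ofReal (ψ x) ^ 2 ≤
      ∫⁻ x in C, ENNReal.ofReal (ψ x) ^ 2 := by
  set mAll : ℝ≥0∞ := ∫⁻ x, ENNReal.ofReal (ψ x) ^ 2 with hmAlldef
  set mC : ℝ≥0∞ := ∫⁻ x in C, ENNReal.ofReal (ψ x) ^ 2 with hmCdef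
  set mφ : ℝ≥0∞ := ∫⁻ y in C, ENNReal.ofReal (φ y) ^ 2 with hmφdef
  set X : ℝ≥0∞ := ∫⁻ y in (D \ C) \ T, ENNReal.ofReal (ψ y) ^ 2 with hXdef
  have hψ2 : Measurable fun x => ENNReal.ofReal (ψ x) ^ 2 := hψm.ennreal_ofReal.pow_const 2
  have hφ2 : Measurable fun x => ENNReal.ofReal (φ x) ^ 2 := hφm.ennreal_ofReal.pow_const 2
  have hAm : MeasurableSet (C \ S) := hC.diff hS
  have hOm : MeasurableSet ((D \ C) \ T) := (hD.diff hC).diff hT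
  have h1ε : 0 < 1 - ε := by linarith
  have hE2 : Real.exp (2 * M) = Real.exp M ^ 2 := by rw [two_mul, Real.exp_add, sq]
  -- the squared outside bound in `ℝ≥0∞`
  have key : ∀ x ∈ C \ S, ∀ y ∈ (D \ C) \ T,
      ENNReal.ofReal (ψ y) ^ 2 * ENNReal.ofReal (φ x) ^ 2 ≤
        ENNReal.ofReal (Real.exp (2 * M)) * (ENNReal.ofReal (ψ x) ^ 2 * ENNReal.ofReal (φ y) ^ 2) := by
    intro x hx y hy
    have h0 : 0 ≤ ψ y * φ x := mul_nonneg (hψ0 y) (hφ0 x)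
    calc ENNReal.ofReal (ψ y) ^ 2 * ENNReal.ofReal (φ x) ^ 2 = ENNReal.ofReal ((ψ y * φ x) ^ 2) := by
          rw [← ENNReal.ofReal_pow (hψ0 y), ← ENNReal.ofReal_pow (hφ0 x),
            ← ENNReal.ofReal_mul (sq_nonneg _), mul_pow]
      _ ≤ ENNReal.ofReal ((Real.exp M * (ψ x * φ y)) ^ 2) :=
          ENNReal.ofReal_le_ofReal (pow_le_pow_left₀ h0 (hout x hx y hy) 2)
      _ = ENNReal.ofReal (Real.exp (2 * M)) *
            (ENNReal.ofReal (ψ x) ^ 2 * ENNReal.ofReal (φ y) ^ 2) := by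
          rw [mul_pow, mul_pow, ← hE2, ENNReal.ofReal_mul (Real.exp_pos _).le,
            ENNReal.ofReal_mul (sq_nonneg _), ENNReal.ofReal_pow (hψ0 x),
            ENNReal.ofReal_pow (hφ0 y)]
  -- Tonelli over `(C ∖ S) × ((D ∖ C) ∖ T)`
  have hstep : X * ∫⁻ x in C \ S, ENNReal.ofReal (φ x) ^ 2 ≤
      ENNReal.ofReal (Real.exp (2 * M)) * (∫⁻ x in C \ S, ENNReal.ofReal (ψ x) ^ 2) *
        ∫⁻ y in (D \ C) \ T, ENNReal.ofReal (φ y) ^ 2 :=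
    calc X * ∫⁻ x in C \ S, ENNReal.ofReal (φ x) ^ 2
        = ∫⁻ y in (D \ C) \ T, ∫⁻ x in C \ S,
            ENNReal.ofReal (ψ y) ^ 2 * ENNReal.ofReal (φ x) ^ 2 :=
          (lintegral_lintegral_mul hψ2.aemeasurable hφ2.aemeasurable).symm
      _ ≤ ∫⁻ y in (D \ C) \ T, ∫⁻ x in C \ S, ENNReal.ofReal (Real.exp (2 * M)) *
            (ENNReal.ofReal (ψ x) ^ 2 * ENNReal.ofReal (φ y) ^ 2) :=
          setLIntegral_mono' hOm fun y hy => setLIntegral_mono' hAm fun x hx => key x hx y hy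
      _ = ∫⁻ y in (D \ C) \ T, ENNReal.ofReal (Real.exp (2 * M)) *
            (∫⁻ x in C \ S, ENNReal.ofReal (ψ x) ^ 2) * ENNReal.ofReal (φ y) ^ 2 := by
          refine lintegral_congr fun y => ?_
          rw [lintegral_const_mul _ (hψ2.mul_const _), lintegral_mul_const _ hψ2, mul_assoc]
      _ = _ := lintegral_const_mul _ hφ2
  -- the three mass bounds
  have hmφt : mφ < ⊤ := lt_of_le_of_lt (lintegral_mono_set hCD) hmφDt
  have hAφ : ENNReal.ofReal (1 - ε) * mφ ≤ ∫⁻ x in C \ S, ENNReal.ofReal (φ x) ^ 2 := by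
    refine (ENNReal.add_le_add_iff_right (a := ENNReal.ofReal ε * mφ)
      (ENNReal.mul_ne_top ENNReal.ofReal_ne_top hmφt.ne)).mp ?_
    calc ENNReal.ofReal (1 - ε) * mφ + ENNReal.ofReal ε * mφ = mφ := by
          rw [← add_mul, ← ENNReal.ofReal_add h1ε.le hε.le, sub_add_cancel,
            ENNReal.ofReal_one, one_mul]
      _ = (∫⁻ y in S, ENNReal.ofReal (φ y) ^ 2) + ∫⁻ y in C \ S, ENNReal.ofReal (φ y) ^ 2 := by
          simpa only [Set.inter_eq_self_of_subset_right hSC] using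
            (lintegral_inter_add_sdiff (μ := volume) (fun y => ENNReal.ofReal (φ y) ^ 2) C hS).symm
      _ ≤ (∫⁻ y in C \ S, ENNReal.ofReal (φ y) ^ 2) + ENNReal.ofReal ε * mφ := by
          rw [add_comm]; exact add_le_add le_rfl hSφ
  have hAψ : (∫⁻ x in C \ S, ENNReal.ofReal (ψ x) ^ 2) ≤ mC := lintegral_mono_set Set.sdiff_subset
  have hOφ : ENNReal.ofReal (c / 16) * ∫⁻ y in (D \ C) \ T, ENNReal.ofReal (φ y) ^ 2 ≤ mφ :=
    (mul_le_mul' le_rfl (lintegral_mono_set (Set.sdiff_subset.trans Set.sdiff_subset))).trans hfrac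
  -- cancel `mφ ∈ (0, ⊤)`: `(1-ε)(c/16) X ≤ e^{2M} ∫_C ψ²`
  have hX : ENNReal.ofReal ((1 - ε) * (c / 16)) * X ≤ ENNReal.ofReal (Real.exp (2 * M)) * mC := by
    refine (ENNReal.mul_le_mul_iff_left hmφ0.ne' hmφt.ne).mp ?_
    calc ENNReal.ofReal ((1 - ε) * (c / 16)) * X * mφ
        = ENNReal.ofReal (c / 16) * (X * (ENNReal.ofReal (1 - ε) * mφ)) := by
          rw [ENNReal.ofReal_mul h1ε.le]; ring
      _ ≤ ENNReal.ofReal (c / 16) * (X * ∫⁻ x in C \ S, ENNReal.ofReal (φ x) ^ 2) :=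
          mul_le_mul' le_rfl (mul_le_mul' le_rfl hAφ)
      _ ≤ ENNReal.ofReal (c / 16) * (ENNReal.ofReal (Real.exp (2 * M)) *
            (∫⁻ x in C \ S, ENNReal.ofReal (ψ x) ^ 2) *
              ∫⁻ y in (D \ C) \ T, ENNReal.ofReal (φ y) ^ 2) := mul_le_mul' le_rfl hstep
      _ = ENNReal.ofReal (Real.exp (2 * M)) * (∫⁻ x in C \ S, ENNReal.ofReal (ψ x) ^ 2) *
            (ENNReal.ofReal (c / 16) * ∫⁻ y in (D \ C) \ T, ENNReal.ofReal (φ y) ^ 2) := by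
          ring
      _ ≤ ENNReal.ofReal (Real.exp (2 * M)) * mC * mφ := mul_le_mul' (mul_le_mul' le_rfl hAψ) hOφ
  -- `∫ ψ² = ∫_C ψ² + ∫_{(D∖C)∩T} ψ² + X ≤ ∫_C ψ² + ε ∫ ψ² + X`
  have hdecomp : mAll ≤ mC + X + ENNReal.ofReal ε * mAll := by
    have h1 : (∫⁻ x in D, ENNReal.ofReal (ψ x) ^ 2) = mAll := by
      refine setLIntegral_eq_of_support_subset fun x hx => ?_
      by_contra hxD
      exact hx (by simp [hψD x hxD])
    have h2 := lintegral_inter_add_sdiff (μ := volume) (fun x => ENNReal.ofReal (ψ x) ^ 2) D hC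
    have h3 := lintegral_inter_add_sdiff (μ := volume) (fun x => ENNReal.ofReal (ψ x) ^ 2)
      (D \ C) hT
    have h4 : (∫⁻ x in (D \ C) ∩ T, ENNReal.ofReal (ψ x) ^ 2) ≤ ENNReal.ofReal ε * mAll :=
      (lintegral_mono_set Set.inter_subset_right).trans hTψ
    rw [Set.inter_eq_self_of_subset_right hCD, ← h3, h1] at h2
    calc mAll = mC + ((∫⁻ x in (D \ C) ∩ T, ENNReal.ofReal (ψ x) ^ 2) + X) := h2.symm
      _ ≤ mC + (ENNReal.ofReal ε * mAll + X) := add_le_add le_rfl (add_le_add h4 le_rfl)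
      _ = mC + X + ENNReal.ofReal ε * mAll := by ring
  have h3ε : ENNReal.ofReal (1 - ε) * mAll ≤ mC + X := by
    refine (ENNReal.add_le_add_iff_right (a := ENNReal.ofReal ε * mAll)
      (ENNReal.mul_ne_top ENNReal.ofReal_ne_top hmAllt.ne)).mp ?_
    calc ENNReal.ofReal (1 - ε) * mAll + ENNReal.ofReal ε * mAll = mAll := by
          rw [← add_mul, ← ENNReal.ofReal_add h1ε.le hε.le, sub_add_cancel, ENNReal.ofReal_one,
            one_mul]
      _ ≤ mC + X + ENNReal.ofReal ε * mAll := hdecomp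
  -- combine: `(1-ε)²(c/16) ∫ ψ² ≤ ((1-ε)(c/16) + e^{2M}) ∫_C ψ²`
  set b : ℝ := (1 - ε) * (c / 16) + Real.exp (2 * M) with hbdef
  have hb : 0 < b := by positivity
  have hfin : ENNReal.ofReal ((1 - ε) * (c / 16) * (1 - ε)) * mAll ≤ ENNReal.ofReal b * mC :=
    calc ENNReal.ofReal ((1 - ε) * (c / 16) * (1 - ε)) * mAll
        = ENNReal.ofReal ((1 - ε) * (c / 16)) * (ENNReal.ofReal (1 - ε) * mAll) := by
          rw [ENNReal.ofReal_mul (by positivity), mul_assoc]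
      _ ≤ ENNReal.ofReal ((1 - ε) * (c / 16)) * (mC + X) := mul_le_mul' le_rfl h3ε
      _ = ENNReal.ofReal ((1 - ε) * (c / 16)) * mC + ENNReal.ofReal ((1 - ε) * (c / 16)) * X :=
          mul_add _ _ _
      _ ≤ ENNReal.ofReal ((1 - ε) * (c / 16)) * mC + ENNReal.ofReal (Real.exp (2 * M)) * mC :=
          add_le_add le_rfl hX
      _ = ENNReal.ofReal b * mC := by
          rw [← add_mul, hbdef, ← ENNReal.ofReal_add (by positivity) (Real.exp_pos _).le]
  have hden : 0 < 1 + 16 * Real.exp (2 * M) / (c * (1 - ε)) := by positivity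
  have hκ₁ : (1 - ε) / (1 + 16 * Real.exp (2 * M) / (c * (1 - ε))) =
      b⁻¹ * ((1 - ε) * (c / 16) * (1 - ε)) := by
    rw [inv_mul_eq_div, div_eq_div_iff hden.ne' hb.ne', hbdef]
    field_simp
  calc ENNReal.ofReal ((1 - ε) / (1 + 16 * Real.exp (2 * M) / (c * (1 - ε)))) * mAll
      = ENNReal.ofReal b⁻¹ * (ENNReal.ofReal ((1 - ε) * (c / 16) * (1 - ε)) * mAll) := by
        rw [hκ₁, ENNReal.ofReal_mul (inv_nonneg.mpr hb.le), mul_assoc]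
    _ ≤ ENNReal.ofReal b⁻¹ * (ENNReal.ofReal b * mC) := mul_le_mul' le_rfl hfin
    _ = mC := by
        rw [← mul_assoc, ← ENNReal.ofReal_mul (inv_nonneg.mpr hb.le), inv_mul_cancel₀ hb.ne',
          ENNReal.ofReal_one, one_mul]

end Summit.AtomisticToContinuum.BoseEinsteinCondensation.CoupledBaths.BoxTransferBath
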